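/-
Copyright (c) 2026 the pub-hodgecm-mathlib formalisation cell (harness21).  Prover seat hodgecm-mathlib-K2Liu-p03 (g9), Track B «K2-LIT» ∕ hLiu418 #184♮ =
`stmt-HodgeConjecture-24832`, socket #41 KIND 1, block K1-b♮ (dec-2-pay) F3 (translate-size brick): «THE SIZE OF A LOCAL SIEGEL SECTION AT A POINT IS CONTROLLED BY THE
ENTRIES OF THE POINT» — the payer-side engine of the value letters `hnear hfar` of ★ F3-loc `K2LiuKindOneLineLocalAbsoluteMajorant`.  THEOREMS ONLY (no `def`, no `instance`,
no notation, no named-fact hypothesis, no `sorry`); lane `--supports stmt-HodgeConjecture-24832 --as helper`.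
-/
import Summits.HodgeConjecture.HodgeConjecture.Theorems.K2LiuKindWFiniteSectionSupBound        -- ★ p864372 §0: `norm_det_le_pow_of_forall_le`, `norm_mul_apply_le` (ultrametric bookkeeping)
import Summits.HodgeConjecture.HodgeConjecture.Theorems.K2LiuSiegelCharacterUnramifiedShift    -- ★ `norm_localSiegelCharacter`
import Summits.HodgeConjecture.HodgeConjecture.Theorems.K2LiuLocalIntertwiningProperty         -- ★ `absDetDelta_pos`
import HarnessLib

/-!
# Crux `HLiu418`, socket #41, KIND 1 b♮ (dec-2-pay) F3 — `K2LiuLocalSiegelSectionEntrySize`: `‖Φ(g)‖ ≤ B_Φ · (∏_{w∣v} (R_g(w)·R_k(w))^n)^{re s + n∕2}` FOR A SIEGEL SECTION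
# `Φ ∈ I_v(s, χ_v)`, A DECOMPOSITION `g = p·k`, ENTRY BOUNDS `R_g, R_k` ON `g_w, (k⁻¹)_w`, AND `‖Φ(k)‖ ≤ B_Φ`

Cell `hodgecm-mathlib`, crux item hLiu418 = `stmt-HodgeConjecture-24832` (helper lane, count-neutral).  Namespace `…Cruxes.HLiu418.K2LiuLocalSiegelSectionEntrySize`.
WHY.  ★ F3-loc `K2LiuKindOneLineLocalAbsoluteMajorant.integrable_and_norm_integral_le` is hypothesis-first on two VALUE letters: bounds `‖f(w_Δ n(X_b) x)‖ ≤ B` (`‖b‖ ≤ 1`)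
and `‖f(w_Δ n(X_{b′}) w_Δ x)‖ ≤ B` (`‖b′‖ ≤ ‖d⁻¹‖`) for the pulled-back local factor `f(y) = Φ(B_v(y)·g_v)` of a Siegel section `Φ` of the BIG group (★ `exists_kindW_factorization`:
`Λ_{s,v}` off `S₀`, flat twists `H_v^{2(s−s₀)}·b ∈ I_v(s,χ_v)` on `S₀`).  Both cells are compact, so every argument `B_v(y)·g_v` has `w`-entries bounded by a constant times the
entries of `g_v` (`≤ H_w(g)`, ★ `norm_apply_evalPlace_le_localHeight`).  THIS FILE is the generic engine turning ENTRY bounds into a SIZE bound (any quadratic `E∕F`, `c`, `δ`,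
rank `n`, Gram datum `T₀`, ANY finite place `v`; D10 currency ★ `IsLocalSiegelSection` ∕ `IsSiegelDelta` ∕ `localSiegelCharacter` ∕ `detDelta`):
with `g = p·k`, `p ∈ P_Δ(F_v)`, the section law gives `Φ(g) = χ_v(det_Δ p)|det_Δ p|_v^{s+n∕2}·Φ(k)`; `det_Δ p_w = det((p_w)₁₁ + (p_w)₁₂)` (★ `detDelta`, `deltaBlock`) has
`‖·‖_w ≤ (R_g(w)·R_k(w))^n` because `p_w = g_w·(k⁻¹)_w` has entries `≤ R_g R_k` (ultrametric products ★ `norm_mul_apply_le`, sums, ★ `norm_det_le_pow_of_forall_le`);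
`|χ_v| = 1` (★ `norm_localSiegelCharacter`), and `0 ≤ re s + n∕2` makes the real power monotone.
* §1 `norm_coe_mul_apply_le` (entries of `(g·h)_w`), `norm_reindex_toBlocks_add_le`, **`norm_detDelta_le_of_entries`** (`‖det_Δ p_w‖_w ≤ R^n` from `|p_w| ≤ R`);
* §2 **`norm_section_le_of_siegel_mul`** (`g = p·k`, entries of `p_w` bounded) and **`norm_section_le_of_decomp`** (entries of `g_w` and `(k⁻¹)_w` bounded) — the size bounds.
References: [Kudla1994, §3]; [HarrisKudlaSweet1996, §1 (1.11)–(1.15)]; [KudlaRallis1994, §2]; [Casselman1980, §3]; [BorelJacquet1979, §1.2]; [Shimura1997, §18.4 Prop. 18.14].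
HONEST LABEL: HC_CM is proved only modulo the 7 printed citations (2 remaining named inputs: hLiu418 = stmt-HodgeConjecture-24832, h413 = stmt-HodgeConjecture-24833) until rung 0
closes; count-neutral helper (`--supports stmt-HodgeConjecture-24832 --as helper`).
-/

set_option autoImplicit false
set_option linter.dupNamespace false -- the mandated namespace repeats `HodgeConjecture.HodgeConjecture`

noncomputable section

open NumberField IsDedekindDomain Matrix
open scoped NNReal
open Literature.NumberTheory.Automorphic Literature.NumberTheory.Automorphic.UnitaryGroup
open Literature.NumberTheory.GelbartRogawski1991.AdaptedBlocks
open Literature.NumberTheory.GelbartRogawski1991.UnitaryDualPair.LocalSplitting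
open Literature.NumberTheory.K2Lit.LocalSiegelDoubled
open Summit.HodgeConjecture.HodgeConjecture.Cruxes.HLiu418.K2LiuKindWFiniteSectionSupBound (norm_det_le_pow_of_forall_le norm_mul_apply_le)
open Summit.HodgeConjecture.HodgeConjecture.Cruxes.HLiu418.K2LiuSiegelCharacterUnramifiedShift (norm_localSiegelCharacter)
open Summit.HodgeConjecture.HodgeConjecture.Cruxes.HLiu418.K2LiuLocalIntertwiningProperty (absDetDelta_pos)

namespace Summit.HodgeConjecture.HodgeConjecture.Cruxes.HLiu418.K2LiuLocalSiegelSectionEntrySize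

variable (F : Type) [Field F] [NumberField F] (E : Type) [Field E] [NumberField E] [Algebra F E]
  [Algebra.IsQuadraticExtension F E] (c : E ≃ₐ[F] E) {δ : E} (hcδ : c δ = -δ) (hδ : δ ≠ 0) {d : F} (hd : δ * δ = algebraMap F E d)
  (v : HeightOneSpectrum (𝓞 F)) (n : ℕ) {T₀ : Matrix (Fin n) (Fin n) F}
  {JD : Matrix (Fin (n + n)) (Fin (n + n)) E} (hJD : JD = (gramD F n T₀).map (algebraMap F E))

/-! ## §1 Entries of products, of the `Δ`-block, and the norm of `det_Δ` -/

section Entries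

omit [Algebra.IsQuadraticExtension F E] in
/-- **entries of a product**: if the `w`-components of `g` and `h` have entries of norm `≤ R_g`, `≤ R_h`, then `(g·h)_w` has entries of norm `≤ R_g·R_h` (ultrametric sum of
`n+n` products). [cite: BorelJacquet1979, §1.2] -/
theorem norm_coe_mul_apply_le (g h : UnitaryGroup.localPi E c (n + n) JD v) (w : PlacesOver E v) {Rg Rh : ℝ} (hRg : 0 ≤ Rg) (hRh : 0 ≤ Rh)
    (hg : ∀ a b, ‖(((g : UnitaryGroup.LocalGLPi E (n + n) v) w : GL (Fin (n + n)) (w.1.adicCompletion E)) : Matrix (Fin (n + n)) (Fin (n + n)) (w.1.adicCompletion E)) a b‖ ≤ Rg)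
    (hh : ∀ a b, ‖(((h : UnitaryGroup.LocalGLPi E (n + n) v) w : GL (Fin (n + n)) (w.1.adicCompletion E)) : Matrix (Fin (n + n)) (Fin (n + n)) (w.1.adicCompletion E)) a b‖ ≤ Rh)
    (a b : Fin (n + n)) :
    ‖((((g * h : UnitaryGroup.localPi E c (n + n) JD v) : UnitaryGroup.LocalGLPi E (n + n) v) w : GL (Fin (n + n)) (w.1.adicCompletion E)) :
        Matrix (Fin (n + n)) (Fin (n + n)) (w.1.adicCompletion E)) a b‖ ≤ Rg * Rh := by
  have hmul : ((((g * h : UnitaryGroup.localPi E c (n + n) JD v) : UnitaryGroup.LocalGLPi E (n + n) v) w : GL (Fin (n + n)) (w.1.adicCompletion E)) :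
        Matrix (Fin (n + n)) (Fin (n + n)) (w.1.adicCompletion E)) =
      (((g : UnitaryGroup.LocalGLPi E (n + n) v) w : GL (Fin (n + n)) (w.1.adicCompletion E)) : Matrix (Fin (n + n)) (Fin (n + n)) (w.1.adicCompletion E)) *
        (((h : UnitaryGroup.LocalGLPi E (n + n) v) w : GL (Fin (n + n)) (w.1.adicCompletion E)) : Matrix (Fin (n + n)) (Fin (n + n)) (w.1.adicCompletion E)) := by
    simp only [Subgroup.coe_mul, Pi.mul_apply, Units.val_mul]
  rw [hmul]
  exact norm_mul_apply_le _ _ hRg hRh hg hh a b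

omit [NumberField F] [NumberField E] [Algebra.IsQuadraticExtension F E] in
/-- entries of the `Δ`-block `M₁₁ + M₁₂` of the `e₂`-re-enumeration of a matrix with entries of norm `≤ R` have norm `≤ R` (ultrametric). [cite: Kudla1994, §3] -/
theorem norm_reindex_toBlocks_add_le {K : Type*} [NormedField K] [IsUltrametricDist K] (M : Matrix (Fin (n + n)) (Fin (n + n)) K) {R : ℝ}
    (hM : ∀ a b, ‖M a b‖ ≤ R) (i j : Fin n) :
    ‖((Matrix.reindex (e₂ n).symm (e₂ n).symm M).toBlocks₁₁ + (Matrix.reindex (e₂ n).symm (e₂ n).symm M).toBlocks₁₂) i j‖ ≤ R := by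
  rw [Matrix.add_apply]
  refine (IsUltrametricDist.norm_add_le_max _ _).trans (max_le ?_ ?_)
  · rw [Matrix.toBlocks₁₁, Matrix.of_apply, Matrix.reindex_apply, Matrix.submatrix_apply]; exact hM _ _
  · rw [Matrix.toBlocks₁₂, Matrix.of_apply, Matrix.reindex_apply, Matrix.submatrix_apply]; exact hM _ _

omit [Algebra.IsQuadraticExtension F E] in
/-- **`‖det_Δ p_w‖_w ≤ R^n`** when the `w`-component of `p` has entries of norm `≤ R` (`det_Δ p_w = det((p_w)₁₁ + (p_w)₁₂)` ★ `detDelta`∕`deltaBlock`; ultrametric Leibniz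
★ `norm_det_le_pow_of_forall_le`). [cite: Kudla1994, §3] [cite: HarrisKudlaSweet1996, §1 (1.15)] [cite: BorelJacquet1979, §1.2] -/
theorem norm_detDelta_le_of_entries (p : UnitaryGroup.localPi E c (n + n) JD v) (w : PlacesOver E v) {R : ℝ} (hR : 0 ≤ R)
    (hp : ∀ a b, ‖(((p : UnitaryGroup.LocalGLPi E (n + n) v) w : GL (Fin (n + n)) (w.1.adicCompletion E)) : Matrix (Fin (n + n)) (Fin (n + n)) (w.1.adicCompletion E)) a b‖ ≤ R) :
    ‖detDelta F E c v n w p‖ ≤ R ^ n := by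
  unfold detDelta deltaBlock
  have h := norm_det_le_pow_of_forall_le _ hR (norm_reindex_toBlocks_add_le n _ hp)
  rwa [Fintype.card_fin] at h

end Entries

/-! ## §2 The size of a Siegel section at a decomposed point -/

section Size

include hJD in
/-- **`‖Φ(g)‖ ≤ B_Φ · (∏_{w∣v} R(w)^n)^{re s + n∕2}`** for a Siegel section `Φ ∈ I_v(s, χ_v)` (`χ_v` unitary, `0 ≤ re s + n∕2`), a decomposition `g = p·k` with `p ∈ P_Δ(F_v)`,
`‖Φ(k)‖ ≤ B_Φ`, and `w`-entries of `p` bounded by `R(w) ≥ 1` (section law, ★ `norm_localSiegelCharacter`, §1). [cite: KudlaRallis1994, §2] [cite: Casselman1980, §3]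
[cite: HarrisKudlaSweet1996, §1 (1.15)] [cite: Shimura1997, §18.4 Prop. 18.14] -/
theorem norm_section_le_of_siegel_mul (hT₀ : T₀.IsSymm) {χv : ∀ w : PlacesOver E v, (w.1.adicCompletion E)ˣ →* ℂˣ}
    (hχu : ∀ (w : PlacesOver E v) (u : (w.1.adicCompletion E)ˣ), ‖((χv w u : ℂˣ) : ℂ)‖ = 1)
    {s : ℂ} (hs : 0 ≤ s.re + (n : ℝ) / 2) {Φ : UnitaryGroup.localPi E c (n + n) JD v → ℂ} (hΦ : IsLocalSiegelSection F E c hcδ hδ hd v n hT₀ hJD χv s Φ)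
    {g p k : UnitaryGroup.localPi E c (n + n) JD v} (hp : IsSiegelDelta F E c hcδ hδ hd v n hT₀ hJD p) (hg : g = p * k)
    {BΦ : ℝ} (hΦk : ‖Φ k‖ ≤ BΦ)
    {R : PlacesOver E v → ℝ} (hR1 : ∀ w, 1 ≤ R w)
    (hpR : ∀ (w : PlacesOver E v) (a b : Fin (n + n)),
      ‖(((p : UnitaryGroup.LocalGLPi E (n + n) v) w : GL (Fin (n + n)) (w.1.adicCompletion E)) : Matrix (Fin (n + n)) (Fin (n + n)) (w.1.adicCompletion E)) a b‖ ≤ R w) :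
    ‖Φ g‖ ≤ BΦ * (∏ w : PlacesOver E v, R w ^ n) ^ (s.re + (n : ℝ) / 2) := by
  have hre : (s + (n : ℂ) / 2).re = s.re + (n : ℝ) / 2 := by simp [Complex.add_re]
  have hdet : absDetDelta F E c v n p ≤ ∏ w : PlacesOver E v, R w ^ n := by
    unfold absDetDelta
    exact Finset.prod_le_prod (fun w _ => norm_nonneg _) fun w _ => norm_detDelta_le_of_entries F E c v n p w (zero_le_one.trans (hR1 w)) (hpR w)
  have hσ : ‖localSiegelCharacter F E c v n χv s p‖ ≤ (∏ w : PlacesOver E v, R w ^ n) ^ (s.re + (n : ℝ) / 2) := by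
    rw [norm_localSiegelCharacter F E c v n χv hχu s p (absDetDelta_pos F E c hcδ hδ hd v n hT₀ hJD hp), hre]
    exact Real.rpow_le_rpow (absDetDelta_nonneg F E c v n p) hdet hs
  rw [hg, hΦ p hp k, norm_mul]
  calc ‖localSiegelCharacter F E c v n χv s p‖ * ‖Φ k‖ ≤ (∏ w : PlacesOver E v, R w ^ n) ^ (s.re + (n : ℝ) / 2) * BΦ :=
        mul_le_mul hσ hΦk (norm_nonneg _) (Real.rpow_nonneg (Finset.prod_nonneg fun w _ => pow_nonneg (zero_le_one.trans (hR1 w)) _) _)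
    _ = BΦ * (∏ w : PlacesOver E v, R w ^ n) ^ (s.re + (n : ℝ) / 2) := mul_comm _ _

include hJD in
/-- **`‖Φ(g)‖ ≤ B_Φ · (∏_{w∣v} (R_g(w)·R_k(w))^n)^{re s + n∕2}`** — the same with the entry bounds placed on `g_w` (`≤ R_g(w)`) and on `(k⁻¹)_w` (`≤ R_k(w)`), `R_g R_k ≥ 1`
(`p = g·k⁻¹`, §1 `norm_coe_mul_apply_le`).  At the tie: `k` in a fixed compact `K₀` with `H(F_v) = P_Δ(F_v)·K₀` (★ `exists_isCompact_isOpen_iwasawa_cm` ∕ a standard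
datum's `K_v`), `R_k` and `B_Φ = sup_{K₀}‖Φ‖` constants, `R_g(w)` = (a compact-cell constant) × `H_w` of the translate. [cite: KudlaRallis1994, §2] [cite: BorelJacquet1979, §1.2]
[cite: HarrisKudlaSweet1996, §1 (1.11)–(1.15)] -/
theorem norm_section_le_of_decomp (hT₀ : T₀.IsSymm) {χv : ∀ w : PlacesOver E v, (w.1.adicCompletion E)ˣ →* ℂˣ}
    (hχu : ∀ (w : PlacesOver E v) (u : (w.1.adicCompletion E)ˣ), ‖((χv w u : ℂˣ) : ℂ)‖ = 1)
    {s : ℂ} (hs : 0 ≤ s.re + (n : ℝ) / 2) {Φ : UnitaryGroup.localPi E c (n + n) JD v → ℂ} (hΦ : IsLocalSiegelSection F E c hcδ hδ hd v n hT₀ hJD χv s Φ)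
    {g p k : UnitaryGroup.localPi E c (n + n) JD v} (hp : IsSiegelDelta F E c hcδ hδ hd v n hT₀ hJD p) (hg : g = p * k)
    {BΦ : ℝ} (hΦk : ‖Φ k‖ ≤ BΦ)
    {Rg Rk : PlacesOver E v → ℝ} (hRg : ∀ w, 0 ≤ Rg w) (hRk : ∀ w, 0 ≤ Rk w) (hR1 : ∀ w, 1 ≤ Rg w * Rk w)
    (hgR : ∀ (w : PlacesOver E v) (a b : Fin (n + n)),
      ‖(((g : UnitaryGroup.LocalGLPi E (n + n) v) w : GL (Fin (n + n)) (w.1.adicCompletion E)) : Matrix (Fin (n + n)) (Fin (n + n)) (w.1.adicCompletion E)) a b‖ ≤ Rg w)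
    (hkR : ∀ (w : PlacesOver E v) (a b : Fin (n + n)),
      ‖((((k⁻¹ : UnitaryGroup.localPi E c (n + n) JD v) : UnitaryGroup.LocalGLPi E (n + n) v) w : GL (Fin (n + n)) (w.1.adicCompletion E)) :
        Matrix (Fin (n + n)) (Fin (n + n)) (w.1.adicCompletion E)) a b‖ ≤ Rk w) :
    ‖Φ g‖ ≤ BΦ * (∏ w : PlacesOver E v, (Rg w * Rk w) ^ n) ^ (s.re + (n : ℝ) / 2) := by
  have hpgk : p = g * k⁻¹ := by rw [hg, mul_inv_cancel_right]
  refine norm_section_le_of_siegel_mul F E c hcδ hδ hd v n hJD hT₀ hχu hs hΦ hp hg hΦk hR1 fun w a b => ?_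
  rw [hpgk]
  exact norm_coe_mul_apply_le F E c v n g k⁻¹ w (hRg w) (hRk w) (hgR w) (hkR w) a b

end Size

end Summit.HodgeConjecture.HodgeConjecture.Cruxes.HLiu418.K2LiuLocalSiegelSectionEntrySize

end
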